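import Literature.Probability.RandomPlanarGeometry.PlaneNonIntersectionLowerBound
import Literature.Probability.LatticeModels.SRWReturnCounts
import Mathlib.NumberTheory.Harmonic.Bounds
import HarnessLib

/-!
# Non-intersecting pairs of planar walks: the recurrence upper bound `N(k)/16^k ≤ 64/(4 + log(k+1))`

Third proof-only companion to `PlaneNonIntersection.lean` (the named fact
`LSW2001_srw_nonIntersection_five_eighths`, Lawler–Schramm–Werner 2001, §1:
`c⁻¹ k^{-5/8} ≤ P[S[0,k] ∩ S'[0,k] = ∅] ≤ c k^{-5/8}` with `P[…] = nonIntersectingPairs k / 16^k`),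
after `PlaneNonIntersectionProofs.lean` (`0 < N(k) ≤ 16^k`) and
`PlaneNonIntersectionLowerBound.lean` (`N(k)/16^k ≥ 1/(2(k+1))`).

What is PROVED here is an elementary UPPER bound showing that the non-intersection probability
tends to `0`, at the logarithmic rate dictated by the recurrence of the planar walk:

  `N(k)/16^k ≤ 64 / (4 + log (k+1))` for `k ≥ 1` (`nonIntersectingPairs_div_le`), hence
  `N(k)/16^k → 0` (`tendsto_nonIntersectingPairs_div`).

The argument (Lawler 1991, §1.2–1.3 style; everything is a finite count):

* **exact step-sequence form** (`nonIntersectingPairs_eq_card_filter_stepSeq`): by the tree's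
  bridge `SRW.sum_walks_eq_sum_stepSeq` for the walk from `0` and its translate
  `sum_walksFrom_eq_sum_stepSeq` (proved here, any start `a`) for the walk from `e₁`,
  `N(k) = #{(ω, ω') : ω(i) ≠ e₁ + ω'(j) for all i, j ≤ k}`;
* **difference walk**: non-intersection forces `e₁ + ω'(j) ≠ ω(j+1)` for `j < k`; reading the
  pair `(ω, ω')` as `(ω₀, ω'_{k-1}, η)` with `η_j = (ω'_j, ω_{j+1})` (`pairEquiv`), the points
  `e₁ + ω'(j) - ω(j+1) = (e₁ - e_{ω₀}) + η(j)` form a walk with the `16` equally likely steps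
  `e_a - e_b` (`dstep`, `dpos`, `pos_pair_eq`), started from one of `e₁ - e_a` and avoiding `0`;
  prefixing the step `(e₁, e_a)` embeds these into the walks from `0` that do not return to `0`
  in `k` steps (`card_filter_avoid_dstep_le`), whence `N(k) ≤ 16 · R_k`
  (`nonIntersectingPairs_le_escape`), `R_m = #{m-step difference walks with no return to 0}`;
* **last-exit decomposition** (`sum_ret_mul_escape_le`): splitting an `m`-step difference walk
  at its last visit to `0` shows `Σ_{j ≤ m} Z_j R_{m-j} ≤ 16^m`, `Z_j = #{j-step walks ending at 0}`
  (the split `PSeq m ≃ PSeq j × PSeq (m-j)` is `splitEquiv`), and `R` is submultiplicative in the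
  crude form `R_m ≤ 16^j R_{m-j}` (`escape_le`), so `(R_m/16^m) · Σ_{j ≤ m} Z_j/16^j ≤ 1`
  (`escape_mul_sum_le`);
* **returns**: `Z_j = Σ_y c_j(y)² = c_{2j}(0)` (`ret_eq_count`, the tree's `SRW.sum_box_count_sq`)
  and `c_{2j}(0) ≥ C(2j,j)²` by the rotation trick (`centralBinom_sq_le_count`: the two diagonal
  coordinates `x ± y` of the planar walk are `±1` walks), so `Z_j/16^j ≥ 1/(4j)`
  (`16^j ≤ 4j C(2j,j)²` from `PlaneNonIntersectionLowerBound.lean`) and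
  `Σ_{j ≤ m} Z_j/16^j ≥ 1 + H_m/4 ≥ 1 + log(m+1)/4` (Mathlib's `log_add_one_le_harmonic`).

The exponent `5/8` (either half of the display) is NOT proved here. For comparison, the sharpest
ELEMENTARY two-sided bounds in print are Lawler 1991, (3.29) = (5.1): `c₁ n⁻¹ ≤ f(n) ≤ c₂ n^{-1/2}`
in `d = 2` for `f(n) = P{S¹(0,n] ∩ S²(0,n] = ∅}` (walks from the same point), whose upper half rests
on the two-sided-walk estimate Thm. 3.5.1 / Cor. 3.6.4 (Green's-function potential theory of Ch. 3)
and Hölder (3.28), and `1/2 + 1/(8π) ≤ ζ₂ < 3/4` (ibid. §5.1, p. 140, Beurling projection); none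
of that potential theory is in the tree, and polynomial decay of `N(k)/16^k` is not proved here.
See the module docstring of `PlaneNonIntersection.lean` for the sources of the fact itself.

## References

* G. F. Lawler, O. Schramm, W. Werner, *Values of Brownian intersection exponents, II: Plane
  exponents*, Acta Math. **187** (2001) 275–308, §1 [LawlerSchrammWerner2001PlaneExponents].
* G. F. Lawler, *Intersections of Random Walks*, Birkhäuser 1991: Prop. 2.4.1(a)
  (`P^x{τ̄_A ≤ n} ≥ Σ_{y ∈ A} G_n(x,y) P^y{τ_A > n}`, proved by "a technique sometimes called a
  last-exit decomposition"; here `A = {0}`, `x = 0`), (3.29) = (5.1) and §5.1 (elementary bounds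
  on `f(n)` and `ζ₂`) [Lawler1991].
* F. Spitzer, *Principles of Random Walk*, 2nd ed. (1976), §1, P1.

Tree: `SRW.StepSeq`, `pos`, `toWalk`, `sum_walks_eq_sum_stepSeq`, `count`,
`sum_stepSeq_eq_sum_box_count`, `sum_box_count_sq` (`SRWStepSequences.lean`,
`SRWReturnCounts.lean`); `signSum`, `card_filter_card_upSteps_eq`,
`sixteen_pow_le_four_mul_mul_centralBinom_sq`, `eq_of_pos_eq`, `pos_apply_zero_add_pos_apply_one`
(`PlaneNonIntersectionLowerBound.lean`). Mathlib: `Fin.cons`/`Fin.snoc`/`Fin.tail`/`Fin.init`,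
`Fintype.bijective_iff_injective_and_card`, `Finset.card_biUnion`, `log_add_one_le_harmonic`.
-/

noncomputable section

open Finset SimpleGraph Literature.Probability.LatticeModels Literature.Probability.LatticeModels.SRW
open scoped BigOperators

namespace Literature.Probability.RandomPlanarGeometry

namespace PlaneNonIntersection

/-! ### Walks from an arbitrary start: translating the step-sequence bridge -/

section Bridge

variable {d n : ℕ}

/-- Translation by `a` as a graph homomorphism of the nearest-neighbour graph of `ℤ^d`.
[folklore] -/
def shiftHom (a : Site d) : zdGraph d →g zdGraph d where
  toFun x := a + x
  map_rel' := by
    intro x y h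
    obtain ⟨i, h | h⟩ := (zdGraph_adj_iff x y).1 h
    · exact (zdGraph_adj_iff _ _).2 ⟨i, Or.inl (by rw [h, add_assoc])⟩
    · exact (zdGraph_adj_iff _ _).2 ⟨i, Or.inr (by rw [h, add_assoc])⟩

/-- `shiftHom a x = a + x`. [folklore] -/
@[simp] theorem shiftHom_apply (a x : Site d) : shiftHom a x = a + x := rfl

/-- The walk from `a` traced by a step sequence: the translate by `a` of `toWalk ω`, visiting
`a + ω(0), …, a + ω(n)`. [folklore] -/
def walkFrom (a : Site d) (ω : StepSeq d n) : (zdGraph d).Walk a (a + endpoint ω) :=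
  ((toWalk ω).map (shiftHom a)).copy (add_zero a) rfl

/-- `walkFrom a ω` visits `a + ω(0), …, a + ω(n)`. [folklore] -/
theorem support_walkFrom (a : Site d) (ω : StepSeq d n) :
    (walkFrom a ω).support = (List.range (n + 1)).map fun k => a + pos ω k := by
  rw [walkFrom, Walk.support_copy, Walk.support_map, support_toWalk, List.map_map]
  rfl

/-- `walkFrom a ω` has length `n`. [folklore] -/
theorem length_walkFrom (a : Site d) (ω : StepSeq d n) : (walkFrom a ω).length = n := by
  rw [walkFrom, Walk.length_copy, Walk.length_map, length_toWalk]

/-- Two walks from the same vertex, packaged with their endpoints, are equal as soon as their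
vertex lists are. [folklore] -/
theorem sigma_walk_ext {V : Type*} {G : SimpleGraph V} {u : V} {s s' : Σ v : V, G.Walk u v}
    (h : s.2.support = s'.2.support) : s = s' := by
  obtain ⟨v, p⟩ := s
  obtain ⟨v', p'⟩ := s'
  dsimp only at h
  have hv : v = v' := by
    rw [← Walk.getLast_support p, ← Walk.getLast_support p']
    exact List.getLast_congr _ _ h
  subst hv
  rw [Walk.ext_support h]

/-- The vertex list of a walk is the list of its vertices `p(0), …, p(|p|)`. [folklore] -/
theorem support_eq_map_getVert {V : Type*} {G : SimpleGraph V} {u v : V} (p : G.Walk u v) :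
    p.support = (List.range (p.length + 1)).map fun k => p.getVert k := by
  apply List.ext_getElem
  · simp [Walk.length_support]
  · intro i h1 h2
    simp only [List.getElem_map, List.getElem_range]
    rw [Walk.getVert_eq_support_getElem p (by rw [Walk.length_support] at h1; omega)]

/-- The step sequence of an `n`-step walk of `zdGraph d` from any vertex, read off consecutive
vertices (the tree's `SRW.ofWalk` is the case of the origin). [folklore] -/
def stepsOf {u x : Site d} (p : (zdGraph d).Walk u x) (hp : p.length = n) : StepSeq d n :=
  fun i => dirOf (p.adj_getVert_succ (i := i) (by rw [hp]; exact i.isLt))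

/-- `stepsOf` recovers the vertices: `u + pos (stepsOf p) k = p(k)` for `k ≤ n`. [folklore] -/
theorem add_pos_stepsOf {u x : Site d} (p : (zdGraph d).Walk u x) (hp : p.length = n) :
    ∀ k, k ≤ n → u + pos (stepsOf p hp) k = p.getVert k
  | 0, _ => by simp
  | k + 1, hk => by
      have h : k < n := hk
      rw [pos_succ _ h, ← add_assoc, add_pos_stepsOf p hp k h.le]
      exact add_stepVec_dirOf _

/-- **Transfer of sums, arbitrary start**: summing over the `n`-step walks of `zdGraph d` from `a`,
indexed as `Σ_{x ∈ X} Σ_{p ∈ finsetWalkLength n a x}` over any finite set `X` of endpoints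
containing all of them, is summing over step sequences. [folklore] -/
theorem sum_walksFrom_eq_sum_stepSeq {M : Type*} [AddCommMonoid M] (a : Site d)
    (X : Finset (Site d)) (hX : ∀ (x : Site d) (p : (zdGraph d).Walk a x), p.length = n → x ∈ X)
    (Φ : (x : Site d) → (zdGraph d).Walk a x → M) :
    ∑ x ∈ X, ∑ p ∈ (zdGraph d).finsetWalkLength n a x, Φ x p =
      ∑ ω : StepSeq d n, Φ (a + endpoint ω) (walkFrom a ω) := by
  rw [← Finset.sum_sigma X (fun x => (zdGraph d).finsetWalkLength n a x) (fun s => Φ s.1 s.2)]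
  symm
  refine Finset.sum_bij'
    (fun ω _ => (⟨a + endpoint ω, walkFrom a ω⟩ : Σ x : Site d, (zdGraph d).Walk a x))
    (fun s hs => stepsOf s.2 (mem_finsetWalkLength_iff.1 (Finset.mem_sigma.1 hs).2))
    ?_ ?_ ?_ ?_ ?_
  · intro ω _
    exact Finset.mem_sigma.2 ⟨hX _ _ (length_walkFrom a ω),
      mem_finsetWalkLength_iff.2 (length_walkFrom a ω)⟩
  · intro s _
    exact Finset.mem_univ _
  · intro ω _
    refine eq_of_pos_eq fun j hj => ?_
    have h := add_pos_stepsOf (walkFrom a ω) (length_walkFrom a ω) j hj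
    rw [Walk.getVert_eq_support_getElem _ (by rw [length_walkFrom]; exact hj)] at h
    simp only [support_walkFrom, List.getElem_map, List.getElem_range] at h
    exact add_left_cancel h
  · rintro ⟨x, p⟩ hs
    have hp : p.length = n := mem_finsetWalkLength_iff.1 (Finset.mem_sigma.1 hs).2
    apply sigma_walk_ext
    dsimp only
    rw [support_walkFrom, support_eq_map_getVert p]
    conv_rhs => rw [hp]
    exact List.map_congr_left fun k hk =>
      add_pos_stepsOf p hp k (Nat.le_of_lt_succ (List.mem_range.1 hk))
  · intro ω _
    rfl

end Bridge

/-! ### `N(k)` as a count of pairs of step sequences -/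

/-- **Exact step-sequence form of `N(k)`**: the number of non-intersecting pairs is the number of
pairs `(ω, ω')` of `k`-step step sequences whose traces `ω(i)` (from `0`) and `e₁ + ω'(j)`
(from `e₁`) never coincide, `i, j ≤ k`. [folklore] -/
theorem nonIntersectingPairs_eq_card_filter_stepSeq (k : ℕ) :
    nonIntersectingPairs k =
      #{x : StepSeq 2 k × StepSeq 2 k | ∀ i ≤ k, ∀ j ≤ k, pos x.1 i ≠ e₁ + pos x.2 j} := by
  classical
  unfold nonIntersectingPairs
  have h1 : ∀ v ∈ box 2 k,
      (∑ w ∈ box 2 (k + 1), ∑ p ∈ (zdGraph 2).finsetWalkLength k (0 : Site 2) v,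
        ∑ q ∈ (zdGraph 2).finsetWalkLength k e₁ w,
          if Disjoint p.support.toFinset q.support.toFinset then 1 else 0) =
      ∑ p ∈ (zdGraph 2).finsetWalkLength k (0 : Site 2) v, ∑ w ∈ box 2 (k + 1),
        ∑ q ∈ (zdGraph 2).finsetWalkLength k e₁ w,
          if Disjoint p.support.toFinset q.support.toFinset then 1 else 0 :=
    fun v _ => Finset.sum_comm
  rw [Finset.sum_congr rfl h1, sum_walks_eq_sum_stepSeq (fun v p => ∑ w ∈ box 2 (k + 1),
    ∑ q ∈ (zdGraph 2).finsetWalkLength k e₁ w,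
      if Disjoint p.support.toFinset q.support.toFinset then 1 else 0)]
  have h2 : ∀ ω : StepSeq 2 k,
      (∑ w ∈ box 2 (k + 1), ∑ q ∈ (zdGraph 2).finsetWalkLength k e₁ w,
        if Disjoint (toWalk ω).support.toFinset q.support.toFinset then 1 else 0) =
      ∑ ω' : StepSeq 2 k,
        if Disjoint (toWalk ω).support.toFinset (walkFrom e₁ ω').support.toFinset then 1 else 0 :=
    fun ω => sum_walksFrom_eq_sum_stepSeq e₁ (box 2 (k + 1))
      (fun w q hq => mem_box_of_walk_e₁ q hq.le) _
  rw [Finset.sum_congr rfl fun ω _ => h2 ω, Finset.card_filter, Fintype.sum_prod_type]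
  refine Finset.sum_congr rfl fun ω _ => Finset.sum_congr rfl fun ω' _ => ?_
  have hiff : Disjoint (toWalk ω).support.toFinset (walkFrom e₁ ω').support.toFinset ↔
      ∀ i ≤ k, ∀ j ≤ k, pos ω i ≠ e₁ + pos ω' j := by
    rw [support_toWalk, support_walkFrom, Finset.disjoint_left]
    simp only [List.mem_toFinset, List.mem_map, List.mem_range]
    constructor
    · intro h i hi j hj heq
      exact h ⟨i, Nat.lt_succ_of_le hi, rfl⟩ ⟨j, Nat.lt_succ_of_le hj, heq.symm⟩
    · rintro h x ⟨i, hi, rfl⟩ ⟨j, hj, hji⟩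
      exact h i (Nat.le_of_lt_succ hi) j (Nat.le_of_lt_succ hj) hji.symm
  by_cases hq : ∀ i ≤ k, ∀ j ≤ k, pos ω i ≠ e₁ + pos ω' j
  · rw [if_pos (hiff.2 hq), if_pos hq]
  · rw [if_neg (fun h => hq (hiff.1 h)), if_neg hq]

/-! ### The difference walk: pair step sequences -/

section DiffWalk

/-- Pair step sequences: the `16^n` sequences of pairs of planar unit steps. [folklore] -/
abbrev PSeq (n : ℕ) : Type := Fin n → Dir 2 × Dir 2

/-- There are `16^n` pair step sequences of length `n`. [folklore] -/
theorem card_pSeq (n : ℕ) : Fintype.card (PSeq n) = 16 ^ n := by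
  rw [Fintype.card_fun, Fintype.card_fin, Fintype.card_prod, card_dir]

/-- The step `e_a - e_b` of the difference walk. [folklore] -/
def dstep (δ : Dir 2 × Dir 2) : Site 2 := stepVec δ.1 - stepVec δ.2

/-- The position `η(k) = Σ_{i<k} (e_{aᵢ} - e_{bᵢ})` of the difference walk after `k` steps
(frozen after time `n`). [folklore] -/
def dpos {n : ℕ} (η : PSeq n) (k : ℕ) : Site 2 :=
  ∑ i ∈ Finset.range k, if h : i < n then dstep (η ⟨i, h⟩) else 0

variable {n m : ℕ}

/-- `η(0) = 0`. [folklore] -/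
@[simp] theorem dpos_zero (η : PSeq n) : dpos η 0 = 0 := by
  simp [dpos]

/-- One more step: `η(k+1) = η(k) + (e_a - e_b)` for `k < n`. [folklore] -/
theorem dpos_succ (η : PSeq n) {k : ℕ} (hk : k < n) :
    dpos η (k + 1) = dpos η k + dstep (η ⟨k, hk⟩) := by
  rw [dpos, Finset.sum_range_succ, dif_pos hk]
  rfl

/-- The final position is the difference of the endpoints of the two coordinate walks.
[folklore] -/
theorem dpos_self_eq (η : PSeq n) :
    dpos η n = endpoint (fun i => (η i).1) - endpoint (fun i => (η i).2) := by
  rw [dpos, endpoint, endpoint, ← Finset.sum_sub_distrib,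
    ← Fin.sum_univ_eq_sum_range (fun i => if h : i < n then dstep (η ⟨i, h⟩) else 0) n]
  refine Finset.sum_congr rfl fun i _ => ?_
  rw [dif_pos i.isLt]
  rfl

/-- Prefixing a step: `(δ·η)(k+1) = (e_a - e_b) + η(k)`. [folklore] -/
theorem dpos_cons_succ (δ : Dir 2 × Dir 2) (η : PSeq n) (k : ℕ) :
    dpos (Fin.cons δ η : PSeq (n + 1)) (k + 1) = dstep δ + dpos η k := by
  unfold dpos
  rw [Finset.sum_range_succ', add_comm, dif_pos (Nat.succ_pos n)]
  congr 1
  refine Finset.sum_congr rfl fun i _ => ?_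
  by_cases h : i < n
  · rw [dif_pos (by omega : i + 1 < n + 1), dif_pos h]
    have e : (⟨i + 1, by omega⟩ : Fin (n + 1)) = Fin.succ ⟨i, h⟩ := rfl
    rw [e, Fin.cons_succ]
  · rw [dif_neg (by omega : ¬ (i + 1 < n + 1)), dif_neg h]

/-- The first `j` steps. [folklore] -/
def pfx (η : PSeq m) (j : ℕ) (hj : j ≤ m) : PSeq j := fun i => η (Fin.castLE hj i)

/-- The steps after the first `j`. [folklore] -/
def sfx (η : PSeq m) (j : ℕ) : PSeq (m - j) := fun i => η ⟨j + i, by omega⟩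

/-- Positions up to time `j` are those of the prefix. [folklore] -/
theorem dpos_pfx (η : PSeq m) {j : ℕ} (hj : j ≤ m) {k : ℕ} (hk : k ≤ j) :
    dpos (pfx η j hj) k = dpos η k := by
  unfold dpos
  refine Finset.sum_congr rfl fun i hi => ?_
  have hi' : i < k := Finset.mem_range.1 hi
  rw [dif_pos (by omega : i < j), dif_pos (by omega : i < m)]
  rfl

/-- Positions after time `j` are `η(j)` plus those of the suffix. [folklore] -/
theorem dpos_add (η : PSeq m) {j : ℕ} (hj : j ≤ m) {k : ℕ} (hk : k ≤ m - j) :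
    dpos η (j + k) = dpos η j + dpos (sfx η j) k := by
  unfold dpos
  rw [Finset.sum_range_add]
  congr 1
  refine Finset.sum_congr rfl fun i hi => ?_
  have hi' : i < k := Finset.mem_range.1 hi
  rw [dif_pos (by omega : j + i < m), dif_pos (by omega : i < m - j)]
  rfl

/-- A pair step sequence is determined by its prefix and suffix. [folklore] -/
theorem eq_of_pfx_eq_of_sfx_eq (η η' : PSeq m) {j : ℕ} (hj : j ≤ m)
    (h1 : pfx η j hj = pfx η' j hj) (h2 : sfx η j = sfx η' j) : η = η' := by
  funext i
  by_cases hi : (i : ℕ) < j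
  · have e : i = Fin.castLE hj ⟨i, hi⟩ := Fin.ext rfl
    rw [e]
    exact congrFun h1 ⟨i, hi⟩
  · have e : i = ⟨j + (i - j), by omega⟩ := Fin.ext (by simp only; omega)
    rw [e]
    exact congrFun h2 ⟨i - j, by omega⟩

/-- **Splitting at time `j`**: `PSeq m ≃ PSeq j × PSeq (m - j)` by prefix and suffix (a
bijection because it is injective between sets of the same size `16^m`). [folklore] -/
def splitEquiv {m j : ℕ} (hj : j ≤ m) : PSeq m ≃ PSeq j × PSeq (m - j) :=
  Equiv.ofBijective (fun η => (pfx η j hj, sfx η j))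
    ((Fintype.bijective_iff_injective_and_card _).2
      ⟨fun η η' h => eq_of_pfx_eq_of_sfx_eq η η' hj (congrArg Prod.fst h) (congrArg Prod.snd h),
        by rw [Fintype.card_prod, card_pSeq, card_pSeq, card_pSeq, ← pow_add,
          Nat.add_sub_cancel' hj]⟩)

/-- `splitEquiv` is prefix-and-suffix. [folklore] -/
@[simp] theorem splitEquiv_apply {m j : ℕ} (hj : j ≤ m) (η : PSeq m) :
    splitEquiv hj η = (pfx η j hj, sfx η j) := rfl

/-! ### Returns and escapes of the difference walk -/

/-- **First-step embedding**: the `n`-step difference walks started from a step value `e_a - e_b`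
and avoiding `0` at all times `≤ n` are no more than the `(n+1)`-step difference walks from `0`
not returning to `0` at times `1, …, n+1` (prefix the step `(a, b)`). [folklore] -/
theorem card_filter_avoid_dstep_le (δ : Dir 2 × Dir 2) (n : ℕ) :
    #{η : PSeq n | ∀ j ≤ n, dstep δ + dpos η j ≠ 0} ≤
      #{η : PSeq (n + 1) | ∀ j < n + 1, dpos η (j + 1) ≠ 0} := by
  refine Finset.card_le_card_of_injOn (fun η => (Fin.cons δ η : PSeq (n + 1))) ?_ ?_
  · intro η hη
    rw [Finset.mem_coe, Finset.mem_filter] at hη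
    rw [Finset.mem_coe, Finset.mem_filter]
    refine ⟨Finset.mem_univ _, fun j hj => ?_⟩
    rw [dpos_cons_succ]
    exact hη.2 j (Nat.le_of_lt_succ hj)
  · intro η _ η' _ h
    have h' := congrArg Fin.tail h
    simpa only [Fin.tail_cons] using h'

/-- **Crude submultiplicativity of escapes**: an `m`-step difference walk with no return to `0`
has, in particular, no return during its first `j` steps: `R_m ≤ R_j · 16^{m-j}`. [folklore] -/
theorem escape_le (m j : ℕ) (hj : j ≤ m) :
    #{η : PSeq m | ∀ i < m, dpos η (i + 1) ≠ 0} ≤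
      #{α : PSeq j | ∀ i < j, dpos α (i + 1) ≠ 0} * 16 ^ (m - j) := by
  rw [← card_pSeq (m - j), ← Finset.card_univ, ← Finset.card_product]
  refine Finset.card_le_card_of_injOn (splitEquiv hj) ?_ (splitEquiv hj).injective.injOn
  intro η hη
  rw [Finset.mem_coe, Finset.mem_filter] at hη
  rw [Finset.mem_coe, Finset.mem_product, splitEquiv_apply, Finset.mem_filter]
  refine ⟨⟨Finset.mem_univ _, fun i hi => ?_⟩, Finset.mem_univ _⟩
  rw [dpos_pfx η hj (by omega : i + 1 ≤ j)]
  exact hη.2 i (by omega)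

/-- **Last-exit decomposition**: splitting an `m`-step difference walk at its last visit to `0`
(a time `j ≤ m`) gives a `j`-step walk ending at `0` followed by an `(m-j)`-step walk with no
return to `0`; the classes are disjoint, so `Σ_{j ≤ m} Z_j · R_{m-j} ≤ 16^m`. [folklore] -/
theorem sum_ret_mul_escape_le (m : ℕ) :
    ∑ j ∈ Finset.range (m + 1),
        #{α : PSeq j | dpos α j = 0} * #{β : PSeq (m - j) | ∀ i < m - j, dpos β (i + 1) ≠ 0} ≤
      16 ^ m := by
  -- the classes `E_j = {η : η(j) = 0, η(j') ≠ 0 for j < j' ≤ m}` inside `PSeq m`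
  have hE : ∀ j ∈ Finset.range (m + 1),
      #{α : PSeq j | dpos α j = 0} * #{β : PSeq (m - j) | ∀ i < m - j, dpos β (i + 1) ≠ 0} =
        #{η : PSeq m | dpos η j = 0 ∧ ∀ i < m - j, dpos η (j + (i + 1)) ≠ 0} := by
    intro j hj
    have hjm : j ≤ m := Nat.le_of_lt_succ (Finset.mem_range.1 hj)
    rw [← Finset.card_product]
    symm
    refine Finset.card_equiv (splitEquiv hjm) fun η => ?_
    simp only [Finset.mem_filter, Finset.mem_product, Finset.mem_univ, true_and,
      splitEquiv_apply]
    rw [dpos_pfx η hjm le_rfl]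
    refine and_congr_right fun h0 => forall₂_congr fun i hi => ?_
    rw [dpos_add η hjm (by omega : i + 1 ≤ m - j), h0, zero_add]
  rw [Finset.sum_congr rfl hE, ← Finset.card_biUnion]
  · calc #((Finset.range (m + 1)).biUnion fun j =>
          ({η : PSeq m | dpos η j = 0 ∧ ∀ i < m - j, dpos η (j + (i + 1)) ≠ 0} : Finset (PSeq m)))
        ≤ #(Finset.univ : Finset (PSeq m)) := Finset.card_le_univ _
      _ = 16 ^ m := by rw [Finset.card_univ, card_pSeq]
  · intro j hj j' hj' hne
    have hjm : j ≤ m := Nat.le_of_lt_succ (Finset.mem_range.1 (Finset.mem_coe.1 hj))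
    have hjm' : j' ≤ m := Nat.le_of_lt_succ (Finset.mem_range.1 (Finset.mem_coe.1 hj'))
    dsimp only [Function.onFun]
    rw [Finset.disjoint_filter]
    rintro η - ⟨h0, h1⟩ ⟨h0', h1'⟩
    rcases lt_or_gt_of_ne hne with hlt | hlt
    · have h := h1 (j' - j - 1) (by omega)
      rw [show j + (j' - j - 1 + 1) = j' by omega] at h
      exact h h0'
    · have h := h1' (j - j' - 1) (by omega)
      rw [show j' + (j - j' - 1 + 1) = j by omega] at h
      exact h h0

/-- **`(R_m / 16^m) · Σ_{j ≤ m} Z_j / 16^j ≤ 1`** in integer form: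
`R_m · Σ_{j ≤ m} Z_j 16^{m-j} ≤ 16^m · 16^m` (last-exit decomposition and `R_m ≤ 16^j R_{m-j}`).
This is Lawler's `1 ≥ P^0{τ̄ ≤ m} ≥ G_m(0,0) P^0{τ > m}` for the difference walk and `A = {0}`.
[cite: Lawler1991, Prop. 2.4.1(a)] -/
theorem escape_mul_sum_le (m : ℕ) :
    #{η : PSeq m | ∀ i < m, dpos η (i + 1) ≠ 0} *
        ∑ j ∈ Finset.range (m + 1), #{α : PSeq j | dpos α j = 0} * 16 ^ (m - j) ≤
      16 ^ m * 16 ^ m := by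
  rw [Finset.mul_sum]
  calc ∑ j ∈ Finset.range (m + 1), #{η : PSeq m | ∀ i < m, dpos η (i + 1) ≠ 0} *
          (#{α : PSeq j | dpos α j = 0} * 16 ^ (m - j))
      ≤ ∑ j ∈ Finset.range (m + 1), 16 ^ m *
          (#{α : PSeq j | dpos α j = 0} *
            #{β : PSeq (m - j) | ∀ i < m - j, dpos β (i + 1) ≠ 0}) := by
        refine Finset.sum_le_sum fun j hj => ?_
        have hjm : j ≤ m := Nat.le_of_lt_succ (Finset.mem_range.1 hj)
        have hmono := escape_le m (m - j) (Nat.sub_le m j)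
        rw [Nat.sub_sub_self hjm] at hmono
        have h16 : 16 ^ j * 16 ^ (m - j) = 16 ^ m := by
          rw [← pow_add, Nat.add_sub_cancel' hjm]
        calc #{η : PSeq m | ∀ i < m, dpos η (i + 1) ≠ 0} *
              (#{α : PSeq j | dpos α j = 0} * 16 ^ (m - j))
            ≤ #{β : PSeq (m - j) | ∀ i < m - j, dpos β (i + 1) ≠ 0} * 16 ^ j *
                (#{α : PSeq j | dpos α j = 0} * 16 ^ (m - j)) := Nat.mul_le_mul_right _ hmono
          _ = 16 ^ j * 16 ^ (m - j) * (#{α : PSeq j | dpos α j = 0} *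
                #{β : PSeq (m - j) | ∀ i < m - j, dpos β (i + 1) ≠ 0}) := by ring
          _ = _ := by rw [h16]
    _ = 16 ^ m * ∑ j ∈ Finset.range (m + 1), #{α : PSeq j | dpos α j = 0} *
          #{β : PSeq (m - j) | ∀ i < m - j, dpos β (i + 1) ≠ 0} := by rw [← Finset.mul_sum]
    _ ≤ 16 ^ m * 16 ^ m := Nat.mul_le_mul_left _ (sum_ret_mul_escape_le m)

/-- **Returns of the difference walk are returns of the planar walk at even times**:
`Z_j = Σ_y c_j(y)² = c_{2j}(0)` (the difference walk is at `0` after `j` steps iff its two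
coordinate walks have the same endpoint). [folklore] -/
theorem ret_eq_count (j : ℕ) : #{α : PSeq j | dpos α j = 0} = count 2 (j + j) 0 := by
  classical
  rw [← sum_box_count_sq]
  rw [Finset.card_equiv (Equiv.arrowProdEquivProdArrow (Fin j) (fun _ => Dir 2) (fun _ => Dir 2))
      (t := Finset.univ.filter fun p : StepSeq 2 j × StepSeq 2 j => endpoint p.1 = endpoint p.2) ?_]
  · rw [Finset.card_filter, Fintype.sum_prod_type]
    have h : ∀ σ : StepSeq 2 j, (∑ τ : StepSeq 2 j, if endpoint σ = endpoint τ then 1 else 0) =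
        count 2 j (endpoint σ) := by
      intro σ
      rw [count_eq_sum_ite]
      refine Finset.sum_congr rfl fun τ _ => ?_
      by_cases hστ : endpoint σ = endpoint τ
      · rw [if_pos hστ, if_pos hστ.symm]
      · rw [if_neg hστ, if_neg fun h' => hστ h'.symm]
    rw [Finset.sum_congr rfl fun σ _ => h σ,
      sum_stepSeq_eq_sum_box_count (fun y => count 2 j y)]
    refine Finset.sum_congr rfl fun y _ => ?_
    rw [smul_eq_mul, sq]
  · intro α
    simp only [Finset.mem_filter, Finset.mem_univ, true_and, Equiv.arrowProdEquivProdArrow,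
      Equiv.coe_fn_mk]
    rw [dpos_self_eq, sub_eq_zero]

/-! ### The rotation trick: `c_{2i}(0) ≥ C(2i, i)²` -/

/-- `e₁ = e_{(0, +)}`. [folklore] -/
theorem stepVec_zero_true : stepVec (((0 : Fin 2), true) : Dir 2) = e₁ := by
  funext i
  fin_cases i <;> simp [stepVec, e₁]

/-- The anti-diagonal coordinate of a unit step of `ℤ²` is `±1`, the sign being the orientation
bit twisted by the axis. [folklore] -/
theorem stepVec_apply_zero_sub_apply_one (v : Dir 2) :
    stepVec v 0 - stepVec v 1 = if (v.2 == decide (v.1 = 0)) = true then 1 else -1 := by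
  obtain ⟨a, b⟩ := v
  fin_cases a <;> cases b <;> simp [stepVec]

/-- **The anti-diagonal coordinate of a planar walk is a `±1` walk**: `ω(j)₀ - ω(j)₁ = S_γ(j)`
with `γᵢ = (bᵢ == [aᵢ = 0])` for the steps `(aᵢ, bᵢ)`. [folklore] -/
theorem pos_apply_zero_sub_pos_apply_one {k : ℕ} (ω : StepSeq 2 k) (j : ℕ) :
    pos ω j 0 - pos ω j 1 = signSum (fun i => ((ω i).2 == decide ((ω i).1 = 0))) j := by
  unfold pos signSum
  rw [Finset.sum_apply, Finset.sum_apply, ← Finset.sum_sub_distrib]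
  refine Finset.sum_congr rfl fun i _ => ?_
  by_cases h : (i : ℕ) < j
  · rw [if_pos h, if_pos h]
    exact stepVec_apply_zero_sub_apply_one (ω i)
  · simp [h]

/-- Boolean bookkeeping for the rotation trick: the twisted bit is recovered. [folklore] -/
theorem beq_decide_ite_eq (b g : Bool) :
    (b == decide ((if g = b then (0 : Fin 2) else 1) = 0)) = g := by
  cases b <;> cases g <;> decide

/-- Boolean bookkeeping for the rotation trick: the axis determines the twisted bit. [folklore] -/
theorem eq_of_ite_eq_ite (b g g' : Bool)
    (h : (if g = b then (0 : Fin 2) else 1) = if g' = b then (0 : Fin 2) else 1) : g = g' := by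
  revert h
  cases b <;> cases g <;> cases g' <;> decide

/-- **Rotation trick (injective half)**: `c_{2i}(0) ≥ C(2i, i)²` — a pair `(β, γ)` of `±1` paths
of length `2i` both ending at `0` determines a planar walk ending at `0` (orientation bit `βₗ`,
axis `0` iff `γₗ = βₗ`), injectively. (With surjectivity this is the classical identity
`c_{2i}(0) = C(2i,i)²`; only the inequality is needed.) [folklore] -/
theorem centralBinom_sq_le_count (i : ℕ) : i.centralBinom ^ 2 ≤ count 2 (i + i) 0 := by
  classical
  have hZ : #{β : Fin (i + i) → Bool | signSum β (i + i) = 0} = i.centralBinom := by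
    rw [Nat.centralBinom_eq_two_mul_choose, two_mul, ← card_filter_card_upSteps_eq (i + i) i]
    congr 1
    refine Finset.filter_congr fun β _ => ?_
    rw [signSum_self_eq]
    push_cast
    omega
  rw [← hZ, sq, ← Finset.card_product, count]
  refine Finset.card_le_card_of_injOn
    (fun p : (Fin (i + i) → Bool) × (Fin (i + i) → Bool) =>
      (fun l => ((if p.2 l = p.1 l then (0 : Fin 2) else 1), p.1 l) : StepSeq 2 (i + i))) ?_ ?_
  · rintro ⟨β, γ⟩ hp
    rw [Finset.mem_coe, Finset.mem_product, Finset.mem_filter, Finset.mem_filter] at hp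
    obtain ⟨⟨-, hβ⟩, -, hγ⟩ := hp
    rw [Finset.mem_coe, Finset.mem_filter]
    refine ⟨Finset.mem_univ _, ?_⟩
    set ω : StepSeq 2 (i + i) := fun l => ((if γ l = β l then (0 : Fin 2) else 1), β l) with hω
    have hsum : endpoint ω 0 + endpoint ω 1 = 0 := by
      rw [← pos_eq_endpoint, pos_apply_zero_add_pos_apply_one]
      exact hβ
    have hdiff : endpoint ω 0 - endpoint ω 1 = 0 := by
      rw [← pos_eq_endpoint, pos_apply_zero_sub_pos_apply_one]
      have hγ' : (fun l => ((ω l).2 == decide ((ω l).1 = 0))) = γ := by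
        funext l
        simp only [hω]
        exact beq_decide_ite_eq (β l) (γ l)
      rw [hγ']
      exact hγ
    funext l
    fin_cases l
    · show endpoint ω 0 = 0
      linarith
    · show endpoint ω 1 = 0
      linarith
  · rintro ⟨β, γ⟩ - ⟨β', γ'⟩ - h
    have hb : β = β' := by
      funext l
      exact congrArg Prod.snd (congrFun h l)
    subst hb
    have hg : γ = γ' := by
      funext l
      have h1 := congrArg Prod.fst (congrFun h l)
      dsimp only at h1
      exact eq_of_ite_eq_ite (β l) (γ l) (γ' l) h1
    rw [hg]

/-- **Lower bound on planar returns**: `16^i ≤ 4i · c_{2i}(0)` for `i ≥ 1`, i.e.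
`P[S_{2i} = 0] ≥ 1/(4i)` (the order `1/(πi)` of the local limit theorem). [folklore] -/
theorem sixteen_pow_le_four_mul_mul_count {i : ℕ} (hi : 1 ≤ i) :
    16 ^ i ≤ 4 * i * count 2 (i + i) 0 :=
  (sixteen_pow_le_four_mul_mul_centralBinom_sq hi).trans
    (Nat.mul_le_mul_left _ (centralBinom_sq_le_count i))

/-! ### From pairs of walks to the difference walk -/

/-- Reading a pair of `(n+1)`-step step sequences `(ω, ω')` as the first step `ω₀` of `ω`, the last
step `ω'ₙ` of `ω'`, and the pair sequence `ηⱼ = (ω'ⱼ, ω_{j+1})`, `j < n`. [folklore] -/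
def pairEquiv (n : ℕ) : StepSeq 2 (n + 1) × StepSeq 2 (n + 1) ≃ (Dir 2 × Dir 2) × PSeq n where
  toFun x := ((x.1 0, x.2 (Fin.last n)), fun i => (x.2 (Fin.castSucc i), x.1 (Fin.succ i)))
  invFun y := (Fin.cons y.1.1 (fun i => (y.2 i).2), Fin.snoc (fun i => (y.2 i).1) y.1.2)
  left_inv x := by
    obtain ⟨ω, ω'⟩ := x
    simp only [Prod.mk.injEq]
    exact ⟨Fin.cons_self_tail ω, Fin.snoc_init_self ω'⟩
  right_inv y := by
    obtain ⟨⟨a, b⟩, η⟩ := y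
    simp

/-- **The difference walk**: for `j ≤ n`,
`e₁ + ω'(j) - ω(j+1) = (e₁ - e_{ω₀}) + η(j)` with `ηᵢ = (ω'ᵢ, ω_{i+1})`. [folklore] -/
theorem pos_pair_eq (ω ω' : StepSeq 2 (n + 1)) :
    ∀ j, j ≤ n → e₁ + pos ω' j - pos ω (j + 1) =
      dstep (((0 : Fin 2), true), ω 0) +
        dpos (fun i => (ω' (Fin.castSucc i), ω (Fin.succ i)) : PSeq n) j
  | 0, _ => by
      rw [pos_zero, add_zero, pos_succ ω (Nat.succ_pos n), pos_zero, zero_add, dpos_zero,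
        add_zero, dstep, stepVec_zero_true]
      rfl
  | j + 1, hj => by
      have h1 : j < n + 1 := by omega
      have h2 : j + 1 < n + 1 := by omega
      have hj' : j < n := hj
      rw [pos_succ ω' h1, pos_succ ω h2, dpos_succ _ hj', ← add_assoc _ (dpos _ j),
        ← pos_pair_eq ω ω' j hj'.le]
      simp only [dstep, Fin.castSucc_mk, Fin.succ_mk]
      abel

/-- Counting the pairs by `(ω₀, ω'ₙ, η)`: the pairs `(ω, ω')` with `e₁ + ω'(j) ≠ ω(j+1)` for all
`j ≤ n` number `Σ_a 4 · A_n(e₁ - e_a)`, `A_n(x)` = the `n`-step difference walks from `x`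
avoiding `0`. [folklore] -/
theorem card_filter_pairs_eq_sum (n : ℕ) :
    #{x : StepSeq 2 (n + 1) × StepSeq 2 (n + 1) | ∀ j ≤ n, e₁ + pos x.2 j ≠ pos x.1 (j + 1)} =
      ∑ a : Dir 2, 4 * #{η : PSeq n | ∀ j ≤ n, dstep (((0 : Fin 2), true), a) + dpos η j ≠ 0} := by
  rw [Finset.card_equiv (pairEquiv n) (t := Finset.univ.filter
      fun y : (Dir 2 × Dir 2) × PSeq n =>
        ∀ j ≤ n, dstep (((0 : Fin 2), true), y.1.1) + dpos y.2 j ≠ 0) ?_]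
  · rw [Finset.card_filter, Fintype.sum_prod_type, Fintype.sum_prod_type]
    refine Finset.sum_congr rfl fun a _ => ?_
    rw [Finset.sum_const_nat (m := #{η : PSeq n |
        ∀ j ≤ n, dstep (((0 : Fin 2), true), a) + dpos η j ≠ 0}) fun b _ => ?_]
    · rw [Finset.card_univ, card_dir]
    · rw [Finset.card_filter]
  · rintro ⟨ω, ω'⟩
    simp only [Finset.mem_filter, Finset.mem_univ, true_and, pairEquiv, Equiv.coe_fn_mk]
    refine forall₂_congr fun j hj => ?_
    rw [← pos_pair_eq ω ω' j hj, sub_ne_zero]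

/-- **`N(n+1) ≤ 16 · R_{n+1}`**: non-intersection forces the difference walk to avoid `0`, and the
difference walks from `e₁ - e_a` avoiding `0` embed into the escapes from `0`. [folklore] -/
theorem nonIntersectingPairs_le_escape (n : ℕ) :
    nonIntersectingPairs (n + 1) ≤ 16 * #{η : PSeq (n + 1) | ∀ j < n + 1, dpos η (j + 1) ≠ 0} := by
  calc nonIntersectingPairs (n + 1)
      ≤ #{x : StepSeq 2 (n + 1) × StepSeq 2 (n + 1) |
          ∀ j ≤ n, e₁ + pos x.2 j ≠ pos x.1 (j + 1)} := by
        rw [nonIntersectingPairs_eq_card_filter_stepSeq]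
        refine Finset.card_le_card fun x hx => ?_
        rw [Finset.mem_filter] at hx ⊢
        exact ⟨hx.1, fun j hj h => hx.2 (j + 1) (by omega) j (by omega) h.symm⟩
    _ = ∑ a : Dir 2, 4 * #{η : PSeq n | ∀ j ≤ n, dstep (((0 : Fin 2), true), a) + dpos η j ≠ 0} :=
        card_filter_pairs_eq_sum n
    _ ≤ ∑ _a : Dir 2, 4 * #{η : PSeq (n + 1) | ∀ j < n + 1, dpos η (j + 1) ≠ 0} :=
        Finset.sum_le_sum fun a _ => Nat.mul_le_mul_left _ (card_filter_avoid_dstep_le _ n)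
    _ = 16 * #{η : PSeq (n + 1) | ∀ j < n + 1, dpos η (j + 1) ≠ 0} := by
        rw [Finset.sum_const, Finset.card_univ, card_dir, smul_eq_mul]
        ring

/-! ### The logarithmic bound -/

/-- **Escape probability of the planar difference walk**: `R_m / 16^m ≤ 4 / (4 + log (m+1))`
(`P(no return in m steps) · (1 + Σ_{j=1}^m P(S_{2j} = 0)) ≤ 1`, `P(S_{2j} = 0) ≥ 1/(4j)`, and
`Σ_{j ≤ m} 1/j ≥ log (m+1)`). [folklore] -/
theorem escape_div_le (m : ℕ) :
    (#{η : PSeq m | ∀ i < m, dpos η (i + 1) ≠ 0} : ℝ) / 16 ^ m ≤ 4 / (4 + Real.log (m + 1)) := by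
  set R : ℝ := (#{η : PSeq m | ∀ i < m, dpos η (i + 1) ≠ 0} : ℝ) with hR
  set S : ℝ := ∑ j ∈ Finset.range (m + 1), (#{α : PSeq j | dpos α j = 0} : ℝ) * 16 ^ (m - j)
    with hS
  have hL : 0 ≤ Real.log (m + 1) := Real.log_nonneg (by norm_cast; omega)
  have h1 : R * S ≤ 16 ^ m * 16 ^ m := by
    have h := escape_mul_sum_le m
    rw [hR, hS]
    exact_mod_cast h
  -- the sum of return probabilities: `S ≥ 16^m (1 + log(m+1)/4)`
  have h2 : (16 : ℝ) ^ m * (1 + Real.log (m + 1) / 4) ≤ S := by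
    have hZ0 : (#{α : PSeq 0 | dpos α 0 = 0} : ℝ) = 1 := by
      have h : #{α : PSeq 0 | dpos α 0 = 0} = 1 := by
        rw [Finset.filter_true_of_mem fun α _ => dpos_zero α, Finset.card_univ, card_pSeq,
          pow_zero]
      exact_mod_cast h
    have hterm : ∀ j ∈ Finset.range m,
        (16 : ℝ) ^ m / (4 * ((j : ℝ) + 1)) ≤
          (#{α : PSeq (j + 1) | dpos α (j + 1) = 0} : ℝ) * 16 ^ (m - (j + 1)) := by
      intro j hj
      have hjm : j < m := Finset.mem_range.1 hj
      have hret : (16 : ℝ) ^ (j + 1) ≤ 4 * ((j : ℝ) + 1) * #{α : PSeq (j + 1) | dpos α (j + 1) = 0} := by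
        rw [ret_eq_count]
        exact_mod_cast sixteen_pow_le_four_mul_mul_count (i := j + 1) (by omega)
      have h16 : (16 : ℝ) ^ m = 16 ^ (j + 1) * 16 ^ (m - (j + 1)) := by
        rw [← pow_add, Nat.add_sub_cancel' (by omega : j + 1 ≤ m)]
      rw [h16, div_le_iff₀ (by positivity)]
      calc (16 : ℝ) ^ (j + 1) * 16 ^ (m - (j + 1))
          ≤ 4 * ((j : ℝ) + 1) * #{α : PSeq (j + 1) | dpos α (j + 1) = 0} * 16 ^ (m - (j + 1)) :=
            mul_le_mul_of_nonneg_right hret (by positivity)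
        _ = _ := by ring
    have hharm : Real.log (m + 1) ≤ ∑ j ∈ Finset.range m, (1 : ℝ) / ((j : ℝ) + 1) := by
      have h := log_add_one_le_harmonic m
      push_cast [harmonic] at h
      simpa [one_div] using h
    calc (16 : ℝ) ^ m * (1 + Real.log (m + 1) / 4)
        = 16 ^ m + (16 ^ m / 4) * Real.log (m + 1) := by ring
      _ ≤ 16 ^ m + (16 ^ m / 4) * ∑ j ∈ Finset.range m, (1 : ℝ) / ((j : ℝ) + 1) := by
          gcongr
      _ = ∑ j ∈ Finset.range m, (16 : ℝ) ^ m / (4 * ((j : ℝ) + 1)) + 16 ^ m := by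
          rw [add_comm, Finset.mul_sum]
          congr 1
          refine Finset.sum_congr rfl fun j _ => ?_
          field_simp
      _ ≤ ∑ j ∈ Finset.range m,
            (#{α : PSeq (j + 1) | dpos α (j + 1) = 0} : ℝ) * 16 ^ (m - (j + 1)) +
            (#{α : PSeq 0 | dpos α 0 = 0} : ℝ) * 16 ^ (m - 0) := by
          rw [hZ0, one_mul, Nat.sub_zero]
          exact add_le_add (Finset.sum_le_sum hterm) le_rfl
      _ = S := by rw [hS, Finset.sum_range_succ']
  have hRnn : 0 ≤ R := by rw [hR]; positivity
  have h3 : R * (16 ^ m * (1 + Real.log (m + 1) / 4)) ≤ 16 ^ m * 16 ^ m :=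
    (mul_le_mul_of_nonneg_left h2 hRnn).trans h1
  have hden : (0 : ℝ) < 4 + Real.log (m + 1) := by linarith
  rw [div_le_div_iff₀ (by positivity) hden]
  nlinarith [h3, pow_pos (show (0 : ℝ) < 16 by norm_num) m]

/-- **Upper bound**: `N(k)/16^k ≤ 64 / (4 + log (k+1))` for `k ≥ 1` — the probability that two
independent `k`-step planar simple random walks from neighbouring vertices do not intersect is
`O(1/log k)` (recurrence of the planar walk). This is NOT the vendored fact
`LSW2001_srw_nonIntersection_five_eighths` (exponent `5/8`). [folklore] -/
theorem nonIntersectingPairs_div_le {k : ℕ} (hk : 1 ≤ k) :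
    (nonIntersectingPairs k : ℝ) / 16 ^ k ≤ 64 / (4 + Real.log (k + 1)) := by
  obtain ⟨n, rfl⟩ : ∃ n, k = n + 1 := ⟨k - 1, by omega⟩
  have h1 : (nonIntersectingPairs (n + 1) : ℝ) ≤
      16 * #{η : PSeq (n + 1) | ∀ j < n + 1, dpos η (j + 1) ≠ 0} := by
    exact_mod_cast nonIntersectingPairs_le_escape n
  have h2 := escape_div_le (n + 1)
  push_cast at h2 ⊢
  calc (nonIntersectingPairs (n + 1) : ℝ) / 16 ^ (n + 1)
      ≤ 16 * ((#{η : PSeq (n + 1) | ∀ j < n + 1, dpos η (j + 1) ≠ 0} : ℝ) / 16 ^ (n + 1)) := by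
        rw [mul_div_assoc']
        exact div_le_div_of_nonneg_right h1 (by positivity)
    _ ≤ 16 * (4 / (4 + Real.log ((n : ℝ) + 1 + 1))) := by
        refine mul_le_mul_of_nonneg_left ?_ (by norm_num)
        simpa [add_assoc] using h2
    _ = 64 / (4 + Real.log ((n : ℝ) + 1 + 1)) := by ring

/-- **The non-intersection probability tends to zero**: `N(k)/16^k → 0` as `k → ∞`.
[folklore] -/
theorem tendsto_nonIntersectingPairs_div :
    Filter.Tendsto (fun k => (nonIntersectingPairs k : ℝ) / 16 ^ k) Filter.atTop (nhds 0) := by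
  have hlog : Filter.Tendsto (fun k : ℕ => 64 / (4 + Real.log ((k : ℝ) + 1))) Filter.atTop
      (nhds 0) := by
    refine Filter.Tendsto.div_atTop tendsto_const_nhds ?_
    refine Filter.tendsto_atTop_add_const_left _ 4 ?_
    have h : Filter.Tendsto (fun k : ℕ => (k : ℝ) + 1) Filter.atTop Filter.atTop :=
      Filter.tendsto_atTop_add_const_right _ 1 tendsto_natCast_atTop_atTop
    exact Real.tendsto_log_atTop.comp h
  refine tendsto_of_tendsto_of_tendsto_of_le_of_le' tendsto_const_nhds hlog ?_ ?_
  · exact Filter.Eventually.of_forall fun k => by positivity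
  · filter_upwards [Filter.eventually_ge_atTop 1] with k hk
    exact nonIntersectingPairs_div_le hk

end DiffWalk

end PlaneNonIntersection

end Literature.Probability.RandomPlanarGeometry

end
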